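import Literature.NumberTheory.Sieve.Maynard2016Lemma93LocalCensus
import HarnessLib

/-!
# Maynard 2016, proof of Lemma 9.3 — the exact main/error skeleton of `y^{(m)}_r` (displays (9.25)–(9.28))

Sources: J. Maynard, *Dense clusters of primes in subsets*, Compositio Math. 152 (2016) 1517–1554 =
arXiv:1405.2593 [Maynard2016DenseClusters], proof of Lemma 9.3, pp. 23–24 (displays (9.25)–(9.28));
K. Ford, B. Green, S. Konyagin, J. Maynard, T. Tao, *Long gaps between primes*, JAMS 31 (2018)
[FordGreenKonyaginMaynardTao2018], §7 (7.8), Theorem 6 (7.13).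

Assembly of the exact algebra of `Maynard2016Lemma93AdmBox`, `…EulerProduct`, `…LocalCensus` into the
shape Maynard's estimate (9.26)–(9.30) is applied to. With `N = ⌊R⌋#`, `r ∈ 𝒟'^{(m)}_k` (`r_m = 1`),
`r' = r[m ↦ c]`, the vectors `e ∈ admBox` with `r ∣ e` are `e = r' ⊙ q` (`c = e_m`, `q ∈ qBox N m (∏ r')`) and

* (EXACT) `y^{(m)}_r = (∏r/φ_L(∏r)) ∑_{c} (1/φ_ω(c)) ∑_{q} y_{r'⊙q} σ(q)/φ_ω(∏q)`
  (`yVarM_eq_sum_divisors_qBox`);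
* (EULER PRODUCT) `I(c) := ∑_{q ∈ qBox N m (∏r')} σ(q)/φ_ω(∏q) = ∏_{p ≤ ⌊R⌋} Λ_p` with the explicit local
  factors of `eulerFactorM_sPrime` (`qSum_sigmaM_eq_prod`, `qSum_sigmaM_eq_prod_explicit`) — display (9.27)
  with «all `p`» replaced by «`p ≤ ⌊R⌋`» (the finite, honest form of subtlety (α));
* (MAIN + ERROR) `y^{(m)}_r = (∏r/φ_L(∏r)) ∑_{c} (y_{r'}/φ_ω(c))·I(c) + (∏r/φ_L(∏r)) ∑_{c} (1/φ_ω(c)) ∑_{q} (y_{r'⊙q} − y_{r'}) σ(q)/φ_ω(∏q)`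
  (`yVarM_eq_main_add_err`): the first term is evaluated by (9.29)–(9.30)
  (`MaynardDense.emSummation`, `FGKMT2018.cM_eq_yPref_mul_prod`), the second is the Lemma 8.2 error of
  (9.26).

## References
* J. Maynard, *Dense clusters of primes in subsets*, Compositio Math. 152 (2016), proof of Lemma 9.3
  pp. 23–24, (9.25)–(9.28) [Maynard2016DenseClusters].
* K. Ford, B. Green, S. Konyagin, J. Maynard, T. Tao, *Long gaps between primes*, JAMS 31 (2018), §7 (7.8),
  Thm 6 (7.13) [FordGreenKonyaginMaynardTao2018].
-/

noncomputable section

open Finset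
open scoped Nat

namespace Literature.NumberTheory.Sieve

namespace FGKMT2018

variable {k : ℕ}

/-! ### The `q`-sum as an Euler product -/

/-- `φ_ω(1) = 1`. [cite: FordGreenKonyaginMaynardTao2018, (7.8) p. 21] -/
theorem phiOmega_one (L : Fin k → ℤ × ℤ) : phiOmega L 1 = 1 := by
  unfold phiOmega; rw [Nat.primeFactors_one, Finset.prod_empty]

/-- **`I = ∑_{q ∈ qBox(N)} σ(q)/φ_ω(∏q) = ∏_{p ∣ N} Λ_p`** for square-free `N` (display (9.27)).
[cite: Maynard2016DenseClusters, proof of Lemma 9.3 p. 24, (9.27)] -/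
theorem qSum_sigmaM_eq_prod {L : Fin k → ℤ × ℤ} {B N : ℕ} (hN : Squarefree N) (m : Fin k) (M : ℕ) :
    ∑ q ∈ qBox L B N m M, sigmaM L m q / phiOmega L (∏ i, q i) =
      ∏ p ∈ N.primeFactors,
        eulerFactorM L B m M (fun p j => sPrimeM L m j p / ((p : ℝ) - omegaL L p)) p := by
  rw [sum_qBox_eq_prod_primeFactors hN m M (fun q => sigmaM L m q / phiOmega L (∏ i, q i))
      (fun p j => sPrimeM L m j p / ((p : ℝ) - omegaL L p)) fun p hp q hq hpq j =>
        sigmaM_div_phiOmega_update_mul L m hq (Nat.prime_of_mem_primeFactors hp) hpq j]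
  simp only [sigmaM_one, Finset.prod_const_one, phiOmega_one, div_one, one_mul]

/-- **The explicit Euler product** (display (9.27) with its local census): for admissible `𝓛` and
square-free `N`, `∑_{q ∈ qBox(N)} σ(q)/φ_ω(∏q) = ∏_{p ∣ N} Λ_p` with `Λ_p = 1` for `p ∣ WB·M` or `p ∣ a_m`,
and `Λ_p = 1 − (ω(p)−1)/((p−1)(p−ω(p))) + [m ∉ admIdx(p)]/(p − ω(p))` otherwise.
[cite: Maynard2016DenseClusters, proof of Lemma 9.3 p. 24, (9.27)–(9.28)] -/
theorem qSum_sigmaM_eq_prod_explicit {L : Fin k → ℤ × ℤ} (hadm : FormsAdmissible L) {B N : ℕ}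
    (hN : Squarefree N) (m : Fin k) (M : ℕ) :
    ∑ q ∈ qBox L B N m M, sigmaM L m q / phiOmega L (∏ i, q i) =
      ∏ p ∈ N.primeFactors,
        (if p.Coprime (wCut k B * B) ∧ ¬ p ∣ M then
          (if p ∣ (L m).1.natAbs then (1 : ℝ)
           else 1 - ((omegaL L p : ℝ) - 1) / (((p : ℝ) - 1) * ((p : ℝ) - omegaL L p)) +
             (if m ∈ admIdx L p then 0 else 1) / ((p : ℝ) - omegaL L p))
        else 1) := by
  rw [qSum_sigmaM_eq_prod hN m M]
  exact Finset.prod_congr rfl fun p hp => eulerFactorM_sPrime hadm B m M (Nat.prime_of_mem_primeFactors hp)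

/-! ### The exact decomposition of `y^{(m)}_r` -/

/-- `∏ᵢ (r'⊙q)ᵢ/rᵢ = c·∏ qᵢ` for `r' = r[m ↦ c]`, `r_m = 1`.
[cite: Maynard2016DenseClusters, proof of Lemma 9.3 p. 24, (9.26)] -/
theorem prod_update_mul_div {r : Fin k → ℕ} (hr : ∀ i, 1 ≤ r i) {m : Fin k} (hrm : r m = 1)
    (c : ℕ) (q : Fin k → ℕ) :
    ∏ i, Function.update r m c i * q i / r i = c * ∏ i, q i := by
  rw [← prod_update_mul q m c]
  refine Finset.prod_congr rfl fun i _ => ?_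
  by_cases hi : i = m
  · subst hi
    rw [Function.update_self, Function.update_self, hrm, Nat.div_one, mul_comm]
  · rw [Function.update_of_ne hi, Function.update_of_ne hi, Nat.mul_div_cancel_left _ (hr i)]

/-- **Exact form of `y^{(m)}_r`** (displays (9.25)–(9.26) before any estimate): for `r ∈ 𝒟'^{(m)}_k`,
`y^{(m)}_r = (∏r/φ_L(∏r)) ∑_{c ∣ ⌊R⌋#, r[m↦c] ∈ admBox} (1/φ_ω(c)) ∑_{q ∈ qBox(⌊R⌋#) m (∏ r[m↦c])} y_{r[m↦c]⊙q} σ(q)/φ_ω(∏q)`.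
[cite: Maynard2016DenseClusters, proof of Lemma 9.3 pp. 23–24, (9.25)–(9.26)] -/
theorem yVarM_eq_sum_divisors_qBox {L : Fin k → ℤ × ℤ} (hadm : FormsAdmissible L) {B : ℕ} {R : ℝ}
    (hR : 1 < R) (F : (Fin k → ℝ) → ℝ) {m : Fin k} {r : Fin k → ℕ} (hr : r ∈ dkBoxP L B R m) :
    yVarM L B R F m r =
      (∏ i, r i : ℕ) / totForm (L m) (∏ i, r i) *
        ∑ c ∈ (primorial ⌊R⌋₊).divisors.filter (fun c => Function.update r m c ∈ admBox L B R),
          1 / phiOmega L c *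
            ∑ q ∈ qBox L B (primorial ⌊R⌋₊) m (∏ i, Function.update r m c i),
              yVar L B R F (fun i => Function.update r m c i * q i) * sigmaM L m q /
                phiOmega L (∏ i, q i) := by
  classical
  have hN : primorial ⌊R⌋₊ ≠ 0 := primorial_ne_zero _
  have hr1 : ∀ i, 1 ≤ r i := one_le_of_mem_dkBox (dkBoxP_subset L B R m hr)
  have hrm : r m = 1 := ((mem_dkBoxP_iff).1 hr).2.1
  rw [yVarM_eq_sum_admBox hadm hR F hr, admBox_eq,
    sum_filter_dvd_admBoxN_eq_sum_divisors hN m hrm]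
  congr 1
  refine Finset.sum_congr rfl fun c hc => ?_
  rw [Finset.mul_sum]
  refine Finset.sum_congr rfl fun q hq => ?_
  obtain ⟨hqN, hqm, hqM⟩ := mem_qBox_iff.1 hq
  have hcq : c.Coprime (∏ i, q i) := by
    have hcd : c ∣ ∏ i, Function.update r m c i := by
      have h := Finset.dvd_prod_of_mem (Function.update r m c) (Finset.mem_univ m)
      rwa [Function.update_self] at h
    exact (Nat.Coprime.coprime_dvd_right hcd hqM).symm
  rw [sPrimeProdM_mul_eq_sigmaM L m hr1 hqm c, prod_update_mul_div hr1 hrm c q,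
    phiOmega_mul_of_coprime L hcq]
  ring

/-- **Main/error skeleton of Lemma 9.3** (the shape to which (9.26)–(9.30) apply): for `r ∈ 𝒟'^{(m)}_k`,
`y^{(m)}_r = (∏r/φ_L) ∑_{c} (y_{r[m↦c]}/φ_ω(c)) · ∏_{p ≤ ⌊R⌋} Λ_p(c)
          + (∏r/φ_L) ∑_{c} (1/φ_ω(c)) ∑_{q} (y_{r[m↦c]⊙q} − y_{r[m↦c]}) σ(q)/φ_ω(∏q)`,
with `Λ_p(c)` the Euler factors of `qSum_sigmaM_eq_prod` for `M = ∏ r[m↦c]`.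
[cite: Maynard2016DenseClusters, proof of Lemma 9.3 p. 24, (9.26)–(9.28)] -/
theorem yVarM_eq_main_add_err {L : Fin k → ℤ × ℤ} (hadm : FormsAdmissible L) {B : ℕ} {R : ℝ}
    (hR : 1 < R) (F : (Fin k → ℝ) → ℝ) {m : Fin k} {r : Fin k → ℕ} (hr : r ∈ dkBoxP L B R m) :
    yVarM L B R F m r =
      (∏ i, r i : ℕ) / totForm (L m) (∏ i, r i) *
          ∑ c ∈ (primorial ⌊R⌋₊).divisors.filter (fun c => Function.update r m c ∈ admBox L B R),
            yVar L B R F (Function.update r m c) / phiOmega L c *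
              ∏ p ∈ (primorial ⌊R⌋₊).primeFactors,
                eulerFactorM L B m (∏ i, Function.update r m c i)
                  (fun p j => sPrimeM L m j p / ((p : ℝ) - omegaL L p)) p +
        (∏ i, r i : ℕ) / totForm (L m) (∏ i, r i) *
          ∑ c ∈ (primorial ⌊R⌋₊).divisors.filter (fun c => Function.update r m c ∈ admBox L B R),
            1 / phiOmega L c *
              ∑ q ∈ qBox L B (primorial ⌊R⌋₊) m (∏ i, Function.update r m c i),
                (yVar L B R F (fun i => Function.update r m c i * q i) -
                    yVar L B R F (Function.update r m c)) * sigmaM L m q / phiOmega L (∏ i, q i) := by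
  classical
  rw [yVarM_eq_sum_divisors_qBox hadm hR F hr, ← mul_add, ← Finset.sum_add_distrib]
  congr 1
  refine Finset.sum_congr rfl fun c hc => ?_
  rw [← qSum_sigmaM_eq_prod (squarefree_primorial _) m, Finset.mul_sum, Finset.mul_sum, Finset.mul_sum,
    ← Finset.sum_add_distrib]
  refine Finset.sum_congr rfl fun q hq => ?_
  ring

end FGKMT2018

end Literature.NumberTheory.Sieve
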